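import Literature.FieldTheory.QuasiAlgClosed.AxKatz
import Mathlib.RingTheory.WittVector.Complete
import Mathlib.FieldTheory.Finite.Basic
import Mathlib.FieldTheory.Perfect
import Mathlib.NumberTheory.Basic
import Mathlib.NumberTheory.Padics.PadicVal.Basic
import Mathlib.Data.Nat.Choose.Multinomial
import Mathlib.Data.Nat.Digits.Lemmas
import Mathlib.Algebra.Ring.GeomSum
import Mathlib.Algebra.MvPolynomial.Degrees
import Mathlib.Data.Rat.Floor
import HarnessLib

/-!
# Proof of the Ax–Katz theorem (`katz_card_zeros_dvd_holds`)

This file discharges the named fact `Literature.FieldTheory.QuasiAlgClosed.katz_card_zeros_dvd`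
(N. M. Katz, *On a theorem of Ax*, Amer. J. Math. 93 (1971) 485–499, Theorem 1.0
[cite: Katz1971, Thm 1.0, p. 485]): for polynomials `F₁,…,F_r` in `n` variables over the finite
field `k` with `q` elements, of degrees `≤ dᵢ` (`dᵢ ≥ 1`),
`q^μ ∣ #{x ∈ kⁿ : F₁(x) = … = F_r(x) = 0}` with `μ = ⌈(n - ∑ dᵢ) / max dᵢ⌉⁺`.

## The proof formalized here

Katz's own proof (loc. cit. §3) runs Dwork's trace formula on `p`-adic Banach spaces and is not
followed. We give instead an elementary proof by **Teichmüller lifting to the Witt ring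
`𝕎 k`** (the "Chevalley–Warning approach" of D. Wan, *A Chevalley–Warning approach to `p`-adic
estimates of character sums*, Proc. AMS 123 (1995) 45–54, combined with the digit-sum lemma of
J. Ax, *Zeroes of polynomials over finite fields*, Amer. J. Math. 86 (1964) 255–261); the argument
was reconstructed independently and is self-contained in this file:

1. `card_zeros_eq_sum`: with `ω : k →* 𝕎 k` the Teichmüller character,
   `N = ∑_{x ∈ kⁿ} ∏ᵢ (1 - ω(Fᵢ(x))^{q-1})` exactly in `𝕎 k`.
2. `sum_congr_mod`: `ω(t) ≡ b (mod p)` whenever `b.coeff 0 = t` (perfectness of `k`), hence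
   `ω(t) = ω(t)^{q^m} ≡ b^{q^m} (mod p^{am+1})`; with `b = L Fᵢ x` (the coefficientwise
   Teichmüller lift of `Fᵢ` evaluated at `ω(x)`) this replaces `ω(Fᵢ x)^{q-1}` by
   `(L Fᵢ x)^{(q-1)q^m}` modulo `p^{am+1}`, `m := μ`.
3. `dvd_sum_prod_one_sub`, `dvd_sum_prod_liftEval_pow`: expand `∏ (1 - gᵢ)` over subsets, each
   `gᵢ^{E}` multinomially (`Finset.sum_pow_eq_sum_piAntidiag`), and sum over `x` first:
   `∑_x ∏_j ω(x_j)^{u_j} = ∏_j S(u_j)` with `S(u) = ∑_{t ∈ k} ω(t)^u ∈ {q, q-1, 0}`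
   (`sum_teichmuller_pow`). A term survives only if all `u_j ≡ 0 (mod q-1)`, and then it is
   `(∏ᵢ multinomialᵢ) · (unit) · q^{#\{j : u_j = 0\}} (q-1)^{…}`.
4. `core_bound` (Ax's lemma, lifted): by Legendre's formula
   `(p-1)·v_p(multinomial) = ∑ s_p(e_w) - s_p(E)` and the rotation weights
   `axR t e ∈ [1, q-1]`, `axR t e ≡ p^t e (mod q-1)`, satisfying
   `(p-1) ∑_{t<a} axR t e ≤ (q-1) s_p(e)` (`axR_sum_le_digits`), one gets
   `a·μ ≤ ∑ᵢ v_p(multinomialᵢ) + a·#\{j : u_j = 0\}` for every surviving term.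
5. `pow_dvd_of_cast_dvd`: `p^{aμ} ∣ (N : 𝕎 k)` forces `q^μ = p^{aμ} ∣ N` in `ℕ`.

No new named facts are introduced (D-0026); everything below is proved.
-/

noncomputable section

open scoped BigOperators

namespace Literature.FieldTheory.QuasiAlgClosed

/-! Throughout, `#harness_tags` conventions of `HarnessLib` apply; the auxiliary namespace
`AxKatzProof` holds the internal lemmas. -/
namespace AxKatzProof

open Finset

/-! ### 1. Digit sums and Ax's rotation weights -/

/-! **Ax's rotation weights.** Throughout, `R : ℕ → ℕ → ℕ` denotes a function satisfying the
defining equation `hR : R t e = if e = 0 then 0 else (p ^ t * e - 1) % (q - 1) + 1`: for `e ≥ 1`,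
`R t e` is the representative of `p^t * e` modulo `q - 1` lying in `[1, q - 1]`, and `R t 0 = 0`.
(It is carried as a hypothesis on `R` rather than as a definition, so that this file adds
theorems only.) -/

/-- `R t 0 = 0`. [folklore] -/
lemma axR_zero {p q : ℕ} {R : ℕ → ℕ → ℕ}
    (hR : ∀ t e, R t e = if e = 0 then 0 else (p ^ t * e - 1) % (q - 1) + 1) (t : ℕ) :
    R t 0 = 0 := by simp [hR]

/-- The defining formula of `R t e` for `e ≠ 0`. [folklore] -/
lemma axR_of_ne_zero {p q : ℕ} {R : ℕ → ℕ → ℕ}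
    (hR : ∀ t e, R t e = if e = 0 then 0 else (p ^ t * e - 1) % (q - 1) + 1) {t e : ℕ} (he : e ≠ 0) :
    R t e = (p ^ t * e - 1) % (q - 1) + 1 := by simp [hR, he]

/-- `R t e ≥ 1` for `e ≠ 0`. [folklore] -/
lemma axR_pos {p q : ℕ} {R : ℕ → ℕ → ℕ}
    (hR : ∀ t e, R t e = if e = 0 then 0 else (p ^ t * e - 1) % (q - 1) + 1) {t e : ℕ} (he : e ≠ 0) :
    0 < R t e := by
  rw [axR_of_ne_zero hR he]; exact Nat.succ_pos _

/-- `R t e ≤ q - 1`. [folklore] -/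
lemma axR_le {p q : ℕ} {R : ℕ → ℕ → ℕ}
    (hR : ∀ t e, R t e = if e = 0 then 0 else (p ^ t * e - 1) % (q - 1) + 1) {t : ℕ} (hq : 2 ≤ q) (e : ℕ) :
    R t e ≤ q - 1 := by
  rcases eq_or_ne e 0 with rfl | he
  · simp [hR]
  rw [axR_of_ne_zero hR he]
  have : (p ^ t * e - 1) % (q - 1) < q - 1 := Nat.mod_lt _ (by omega)
  omega

/-- `R t e ≡ p ^ t * e (mod q - 1)`. [folklore] -/
lemma axR_modEq {p q : ℕ} {R : ℕ → ℕ → ℕ}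
    (hR : ∀ t e, R t e = if e = 0 then 0 else (p ^ t * e - 1) % (q - 1) + 1) (hp : 0 < p) (t e : ℕ) :
    R t e ≡ p ^ t * e [MOD q - 1] := by
  rcases eq_or_ne e 0 with rfl | he
  · simp [hR, Nat.ModEq.refl]
  rw [axR_of_ne_zero hR he]
  have h1 : 1 ≤ p ^ t * e := Nat.one_le_iff_ne_zero.mpr (by positivity)
  calc (p ^ t * e - 1) % (q - 1) + 1 ≡ (p ^ t * e - 1) + 1 [MOD q - 1] :=
        Nat.ModEq.add_right 1 (Nat.mod_modEq _ _)
    _ = p ^ t * e := Nat.sub_add_cancel h1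

/-- The basic minimality property: a positive number congruent to `m ≥ 1` dominates
`(m - 1) % (q - 1) + 1`. [folklore] -/
lemma mod_pred_succ_le {q m s : ℕ} (hm : 1 ≤ m) (hs : 1 ≤ s) (h : m ≡ s [MOD q - 1]) :
    (m - 1) % (q - 1) + 1 ≤ s := by
  have h' : m - 1 ≡ s - 1 [MOD q - 1] := by
    apply Nat.ModEq.add_right_cancel' 1
    rwa [Nat.sub_add_cancel hm, Nat.sub_add_cancel hs]
  have : (m - 1) % (q - 1) = (s - 1) % (q - 1) := h'
  rw [this]
  have := Nat.mod_le (s - 1) (q - 1)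
  omega

/-- Subadditivity of the rotation weights: `R t (x + y) ≤ R t x + R t y`. [folklore] -/
lemma axR_add_le {p q : ℕ} {R : ℕ → ℕ → ℕ}
    (hR : ∀ t e, R t e = if e = 0 then 0 else (p ^ t * e - 1) % (q - 1) + 1) (hp : 0 < p) (t x y : ℕ) :
    R t (x + y) ≤ R t x + R t y := by
  rcases eq_or_ne x 0 with rfl | hx
  · simp [axR_zero hR]
  rcases eq_or_ne y 0 with rfl | hy
  · simp [axR_zero hR]
  rw [axR_of_ne_zero hR (by omega : x + y ≠ 0)]
  apply mod_pred_succ_le (Nat.one_le_iff_ne_zero.mpr (by positivity))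
    (le_add_right (axR_pos hR hx))
  rw [mul_add]
  exact ((axR_modEq hR hp t x).add (axR_modEq hR hp t y)).symm

/-- Multiplying `e` by `p` shifts the rotation index: `R t (p e) = R (t+1) e`. [folklore] -/
lemma axR_mul_base {p q : ℕ} {R : ℕ → ℕ → ℕ}
    (hR : ∀ t e, R t e = if e = 0 then 0 else (p ^ t * e - 1) % (q - 1) + 1) (hp : 0 < p) (t e : ℕ) :
    R t (p * e) = R (t + 1) e := by
  rcases eq_or_ne e 0 with rfl | he
  · simp [axR_zero hR]
  rw [axR_of_ne_zero hR he, axR_of_ne_zero hR (by positivity), pow_succ, mul_assoc]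

/-- The rotation weights are `a`-periodic in `t` (`p ^ a ≡ 1 (mod q - 1)`). [folklore] -/
lemma axR_add_period {p q a : ℕ} {R : ℕ → ℕ → ℕ}
    (hR : ∀ t e, R t e = if e = 0 then 0 else (p ^ t * e - 1) % (q - 1) + 1) (hp : 0 < p) (hq : q = p ^ a) (t e : ℕ) :
    R (t + a) e = R t e := by
  rcases eq_or_ne e 0 with rfl | he
  · simp [axR_zero hR]
  rw [axR_of_ne_zero hR he, axR_of_ne_zero hR he]
  congr 1
  obtain ⟨X, hX⟩ : ∃ X, p ^ t * e = X + 1 :=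
    Nat.exists_eq_add_one_of_ne_zero (by positivity)
  obtain ⟨Q, hQ⟩ : ∃ Q, p ^ a = Q + 1 := Nat.exists_eq_add_one_of_ne_zero (by positivity)
  have : p ^ (t + a) * e - 1 = (p ^ t * e - 1) + (X + 1) * (q - 1) := by
    rw [pow_add, mul_right_comm, hX, hq, hQ]
    simp only [Nat.add_sub_cancel]
    ring_nf
    omega
  rw [this, Nat.add_mul_mod_self_right]

/-- For a single digit `1 ≤ c ≤ p - 1` and `t < a`, `R t c = p ^ t c`. [folklore] -/
lemma axR_small {p q a : ℕ} {R : ℕ → ℕ → ℕ}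
    (hR : ∀ t e, R t e = if e = 0 then 0 else (p ^ t * e - 1) % (q - 1) + 1) {t c : ℕ} (hq : q = p ^ a) (ht : t < a) (hc1 : 1 ≤ c)
    (hcp : c < p) : R t c = p ^ t * c := by
  have hp : 0 < p := by omega
  rw [axR_of_ne_zero hR (by omega)]
  have hlt : p ^ t * c < q := by
    calc p ^ t * c < p ^ t * p := Nat.mul_lt_mul_of_pos_left hcp (by positivity)
      _ = p ^ (t + 1) := (pow_succ _ _).symm
      _ ≤ p ^ a := Nat.pow_le_pow_right hp ht
      _ = q := hq.symm
  have h1 : 1 ≤ p ^ t * c := Nat.one_le_iff_ne_zero.mpr (by positivity)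
  rw [Nat.mod_eq_of_lt (by omega)]
  omega

/-- A sum over a full period is invariant under shifting the index by one. [folklore] -/
lemma sum_range_shift_periodic {a : ℕ} (f : ℕ → ℕ) (hf : f a = f 0) :
    ∑ t ∈ range a, f (t + 1) = ∑ t ∈ range a, f t := by
  rcases Nat.eq_zero_or_pos a with rfl | ha
  · simp
  obtain ⟨b, rfl⟩ : ∃ b, a = b + 1 := ⟨a - 1, by omega⟩
  rw [Finset.sum_range_succ, Finset.sum_range_succ', hf]

/-- `∑_{t<a} R t (p e) = ∑_{t<a} R t e`. [folklore] -/
lemma sum_axR_mul_base {p q a : ℕ} {R : ℕ → ℕ → ℕ}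
    (hR : ∀ t e, R t e = if e = 0 then 0 else (p ^ t * e - 1) % (q - 1) + 1) (hp : 0 < p) (hq : q = p ^ a) (e : ℕ) :
    ∑ t ∈ range a, R t (p * e) = ∑ t ∈ range a, R t e := by
  simp_rw [axR_mul_base hR hp]
  exact sum_range_shift_periodic (fun t => R t e) (by simpa using axR_add_period hR hp hq 0 e)

/-- `(p - 1) (1 + p + ⋯ + p^{a-1}) = p^a - 1` in `ℕ`. [folklore] -/
lemma pred_mul_geom_sum (p a : ℕ) (hp : 0 < p) : (p - 1) * ∑ t ∈ range a, p ^ t = p ^ a - 1 := by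
  have h1 : 1 ≤ p ^ a := Nat.one_le_iff_ne_zero.mpr (by positivity)
  zify [hp, h1]
  have := geom_sum_mul (p : ℤ) a
  linarith [this]

/-- Base-`p` digit sum of `p e + c` for a digit `c < p`. [folklore] -/
lemma digits_sum_base_mul_add {p : ℕ} (hp : 1 < p) (e c : ℕ) (hc : c < p) (h : 0 < p * e + c) :
    (Nat.digits p (p * e + c)).sum = c + (Nat.digits p e).sum := by
  rw [Nat.digits_def' hp h]
  have h0 : 0 < p := by omega
  simp [Nat.mod_eq_of_lt hc, Nat.mul_add_div h0, Nat.div_eq_of_lt hc]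

/-- **Ax's digit-sum inequality** (lifted form): for `e ≥ 1`,
`(p - 1) * ∑_{t < a} axR t e ≤ (q - 1) * s_p(e)`.
(The digit-sum device goes back to Ax (1964); this lifted form is elementary.) [folklore] -/
lemma axR_sum_le_digits {p q a : ℕ} {R : ℕ → ℕ → ℕ}
    (hR : ∀ t e, R t e = if e = 0 then 0 else (p ^ t * e - 1) % (q - 1) + 1) (hp : p.Prime) (hq : q = p ^ a) :
    ∀ e, (p - 1) * ∑ t ∈ range a, R t e ≤ (q - 1) * (Nat.digits p e).sum := by
  intro e
  induction e using Nat.strong_induction_on with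
  | _ e ih =>
    rcases Nat.eq_zero_or_pos e with rfl | he
    · simp [axR_zero hR]
    have hp1 : 1 < p := hp.one_lt
    have hp0 : 0 < p := hp.pos
    set e' := e / p with he'
    set c := e % p with hc
    have hdecomp : p * e' + c = e := Nat.div_add_mod e p
    have hcp : c < p := Nat.mod_lt _ hp0
    have he'lt : e' < e := Nat.div_lt_self he hp1
    have ih' : (p - 1) * ∑ t ∈ range a, R t e' ≤ (q - 1) * (Nat.digits p e').sum := ih e' he'lt
    rw [← hdecomp]
    rw [← hdecomp] at he
    rw [digits_sum_base_mul_add hp1 e' c hcp he]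
    rcases Nat.eq_zero_or_pos c with hc0 | hcpos
    · rw [hc0, add_zero, zero_add, sum_axR_mul_base hR hp0 hq]
      exact ih'
    · calc (p - 1) * ∑ t ∈ range a, R t (p * e' + c)
          ≤ (p - 1) * (∑ t ∈ range a, R t (p * e') + ∑ t ∈ range a, R t c) := by
            apply Nat.mul_le_mul_left
            rw [← Finset.sum_add_distrib]
            exact Finset.sum_le_sum fun t _ => axR_add_le hR hp0 t _ _
        _ = (p - 1) * ∑ t ∈ range a, R t e' + (p - 1) * ∑ t ∈ range a, p ^ t * c := by
            rw [mul_add, sum_axR_mul_base hR hp0 hq]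
            congr 2
            exact Finset.sum_congr rfl fun t ht => axR_small hR hq (Finset.mem_range.mp ht) hcpos hcp
        _ = (p - 1) * ∑ t ∈ range a, R t e' + (q - 1) * c := by
            rw [← Finset.sum_mul, ← mul_assoc, pred_mul_geom_sum p a hp0, hq]
        _ ≤ (q - 1) * (Nat.digits p e').sum + (q - 1) * c := by gcongr
        _ = (q - 1) * (c + (Nat.digits p e').sum) := by ring

/-- Digit sum of `(q - 1) * q ^ m` in base `p`, `q = p ^ a`. [folklore] -/
lemma digits_sum_E {p a : ℕ} (hp : p.Prime) (m : ℕ) :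
    (Nat.digits p ((p ^ a - 1) * (p ^ a) ^ m)).sum = a * (p - 1) := by
  have hp1 : 1 < p := hp.one_lt
  have key : ∀ b, (Nat.digits p (p ^ b - 1)).sum = b * (p - 1) := by
    intro b
    induction b with
    | zero => simp
    | succ b ihb =>
      have h1 : 1 ≤ p ^ b := Nat.one_le_iff_ne_zero.mpr (by positivity)
      have : p ^ (b + 1) - 1 = p * (p ^ b - 1) + (p - 1) := by
        rw [pow_succ]
        zify [h1, hp.pos, Nat.one_le_iff_ne_zero.mpr (show p ^ b * p ≠ 0 by positivity)]
        ring
      rw [this, digits_sum_base_mul_add hp1 _ _ (by omega) (by omega), ihb]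
      ring
  rcases Nat.eq_zero_or_pos (p ^ a - 1) with h0 | hpos
  · rw [h0, zero_mul]
    have : a = 0 := by
      by_contra ha
      have : p ^ 1 ≤ p ^ a := Nat.pow_le_pow_right hp.pos (Nat.one_le_iff_ne_zero.mpr ha)
      simp at this; omega
    simp [this]
  rw [← pow_mul, mul_comm, Nat.digits_base_pow_mul hp1 hpos]
  simp [key]

/-! ### 2. Legendre's formula for multinomial coefficients -/

/-- `padicValNat` of a product of nonzero naturals. [folklore] -/
lemma padicValNat_prod {α : Type*} (p : ℕ) [Fact p.Prime] (s : Finset α) (g : α → ℕ) (hg : ∀ i ∈ s, g i ≠ 0) :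
    padicValNat p (∏ i ∈ s, g i) = ∑ i ∈ s, padicValNat p (g i) := by
  classical
  induction s using Finset.induction_on with
  | empty => simp
  | insert a s ha ih =>
    rw [Finset.prod_insert ha, Finset.sum_insert ha,
      padicValNat.mul (hg a (by simp)) (Finset.prod_ne_zero_iff.mpr fun i hi => hg i (by simp [hi])),
      ih fun i hi => hg i (by simp [hi])]

/-- **Legendre's formula for multinomial coefficients.** [folklore] -/
lemma legendre_multinomial {α : Type*} (p : ℕ) [hp : Fact p.Prime] (s : Finset α) (f : α → ℕ) :
    (p - 1) * padicValNat p (Nat.multinomial s f) + (Nat.digits p (∑ i ∈ s, f i)).sum =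
      ∑ i ∈ s, (Nat.digits p (f i)).sum := by
  have hspec := Nat.multinomial_spec s f
  have h1 := sub_one_mul_padicValNat_factorial (p := p) (∑ i ∈ s, f i)
  have h2 : ∀ i, (p - 1) * padicValNat p ((f i).factorial) = f i - (Nat.digits p (f i)).sum :=
    fun i => sub_one_mul_padicValNat_factorial _
  have h3 : padicValNat p ((∑ i ∈ s, f i).factorial) =
      ∑ i ∈ s, padicValNat p ((f i).factorial) + padicValNat p (Nat.multinomial s f) := by
    rw [← hspec, padicValNat.mul (Finset.prod_ne_zero_iff.mpr fun i _ => Nat.factorial_ne_zero _)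
      (Nat.multinomial_pos s f).ne', padicValNat_prod _ _ _ fun i _ => Nat.factorial_ne_zero _]
  have h4 : (p - 1) * padicValNat p ((∑ i ∈ s, f i).factorial) =
      ∑ i ∈ s, (p - 1) * padicValNat p ((f i).factorial) +
        (p - 1) * padicValNat p (Nat.multinomial s f) := by
    rw [h3, mul_add, Finset.mul_sum]
  rw [h1] at h4
  simp_rw [h2] at h4
  have hle : ∀ i, (Nat.digits p (f i)).sum ≤ f i := fun i => Nat.digit_sum_le _ _
  have hle' : (Nat.digits p (∑ i ∈ s, f i)).sum ≤ ∑ i ∈ s, f i := Nat.digit_sum_le _ _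
  have h5 : ∑ i ∈ s, (f i - (Nat.digits p (f i)).sum) + ∑ i ∈ s, (Nat.digits p (f i)).sum =
      ∑ i ∈ s, f i := by
    rw [← Finset.sum_add_distrib]
    exact Finset.sum_congr rfl fun i _ => Nat.sub_add_cancel (hle i)
  omega

/-! ### 3. The combinatorial core (Ax's lemma, lifted to `𝕎`) -/

/-- Sums preserve congruences. [folklore] -/
lemma modEq_sum {α : Type*} {N : ℕ} (s : Finset α) {f g : α → ℕ}
    (h : ∀ i ∈ s, f i ≡ g i [MOD N]) : ∑ i ∈ s, f i ≡ ∑ i ∈ s, g i [MOD N] := by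
  classical
  induction s using Finset.induction_on with
  | empty => simp [Nat.ModEq.refl]
  | insert a s ha ih =>
    rw [Finset.sum_insert ha, Finset.sum_insert ha]
    exact (h a (by simp)).add (ih fun i hi => h i (by simp [hi]))

/-- **The combinatorial core of the Ax–Katz theorem** (Ax's lemma, in lifted form).
`ι` indexes the polynomials, `W i` the support of the `i`-th one (monomials of degree `≤ d i ≤ D`),
`e i` a multi-index with `∑_{w ∈ W i} e i w = E = (q - 1) q ^ m`; `u j = ∑_{i,w} e i w * w j` is the
exponent of the `j`-th variable in the corresponding term. If all `u j` are multiples of `q - 1`,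
then `a * μ ≤ ∑_i v_p(multinomial (W i) (e i)) + a * #{j | u j = 0}` whenever
`μ` is dominated by every `K` with `n ≤ D * K + S`, `S ≥ ∑ d i`.
(Exponent bookkeeping of Katz's `μ`; the digit-sum device goes back to Ax (1964).)
[cite: Katz1971, Thm 1.0, p. 485] -/
theorem core_bound {p a q m n : ℕ} (hp : p.Prime) (ha : 0 < a) (hq : q = p ^ a)
    {ι : Type*} [Fintype ι] [DecidableEq ι]
    (W : ι → Finset (Fin n →₀ ℕ)) (e : ι → (Fin n →₀ ℕ) → ℕ) (d : ι → ℕ) (D S μ : ℕ)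
    (hdeg : ∀ i, ∀ w ∈ W i, ∑ j, w j ≤ d i) (hdD : ∀ i, d i ≤ D) (hD : 1 ≤ D) (hS : ∑ i, d i ≤ S)
    (hμ : ∀ K : ℕ, n ≤ D * K + S → μ ≤ K)
    (he : ∀ i, ∑ w ∈ W i, e i w = (q - 1) * q ^ m)
    (hu : ∀ j : Fin n, (q - 1) ∣ ∑ i, ∑ w ∈ W i, e i w * w j) :
    haveI : Fact p.Prime := ⟨hp⟩
    a * μ ≤ ∑ i, padicValNat p (Nat.multinomial (W i) (e i)) +
      a * #(univ.filter fun j : Fin n => ∑ i, ∑ w ∈ W i, e i w * w j = 0) := by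
  haveI : Fact p.Prime := ⟨hp⟩
  have hp0 : 0 < p := hp.pos
  have hp1 : 1 < p := hp.one_lt
  have hq2 : 2 ≤ q := by
    rw [hq]; calc 2 ≤ p := hp1
      _ = p ^ 1 := (pow_one p).symm
      _ ≤ p ^ a := Nat.pow_le_pow_right hp0 ha
  have hq1 : 0 < q - 1 := by omega
  -- Ax's rotation weights (see §1)
  obtain ⟨R, hR⟩ : ∃ R : ℕ → ℕ → ℕ, ∀ t e, R t e = if e = 0 then 0 else (p ^ t * e - 1) % (q - 1) + 1 :=
    ⟨_, fun _ _ => rfl⟩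
  set u : Fin n → ℕ := fun j => ∑ i, ∑ w ∈ W i, e i w * w j with hu_def
  set J : Finset (Fin n) := univ.filter fun j => u j ≠ 0 with hJ_def
  set Z : Finset (Fin n) := univ.filter fun j => u j = 0 with hZ_def
  have hJZ : #J + #Z = n := by
    have := Finset.card_filter_add_card_filter_not (s := (univ : Finset (Fin n)))
      (fun j => u j ≠ 0)
    simp only [not_not, card_univ, Fintype.card_fin] at this
    convert this using 2
  -- the rotation sums are multiples of q - 1
  have hdiv : ∀ i t, (q - 1) ∣ ∑ w ∈ W i, R t (e i w) := by
    intro i t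
    have h1 : ∑ w ∈ W i, R t (e i w) ≡ ∑ w ∈ W i, p ^ t * e i w [MOD q - 1] :=
      modEq_sum _ fun w _ => axR_modEq hR hp0 t (e i w)
    rw [← Finset.mul_sum, he i] at h1
    apply (Nat.modEq_zero_iff_dvd).mp
    refine h1.trans ?_
    apply Nat.modEq_zero_iff_dvd.mpr
    exact Dvd.dvd.mul_left (dvd_mul_right _ _) _
  -- define τ i t with (q-1) * (τ i t + 1) = ∑_w axR
  have hστ : ∀ i t, ∃ τ : ℕ, (q - 1) * (τ + 1) = ∑ w ∈ W i, R t (e i w) := by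
    intro i t
    obtain ⟨c, hc⟩ := hdiv i t
    have hpos : 0 < ∑ w ∈ W i, R t (e i w) := by
      have hE : ∑ w ∈ W i, e i w ≠ 0 := by
        rw [he i]; exact Nat.mul_ne_zero (by omega) (by positivity)
      obtain ⟨w, hw, hw0⟩ := Finset.exists_ne_zero_of_sum_ne_zero hE
      exact lt_of_lt_of_le (axR_pos hR hw0)
        (Finset.single_le_sum (f := fun w => R t (e i w)) (fun _ _ => Nat.zero_le _) hw)
    have hc0 : c ≠ 0 := by rintro rfl; rw [mul_zero] at hc; omega
    exact ⟨c - 1, by rw [Nat.sub_add_cancel (Nat.one_le_iff_ne_zero.mpr hc0)]; exact hc.symm⟩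
  choose τ hτ using hστ
  -- Step 1: #J ≤ D * ∑ τ + S for every t
  have hJle : ∀ t, #J ≤ D * ∑ i, τ i t + S := by
    intro t
    have h1 : (q - 1) * #J ≤ ∑ j ∈ J, ∑ i, ∑ w ∈ W i, R t (e i w) * w j := by
      rw [mul_comm, Finset.card_eq_sum_ones, Finset.sum_mul, one_mul]
      apply Finset.sum_le_sum
      intro j hj
      have hj' : u j ≠ 0 := (Finset.mem_filter.mp hj).2
      apply Nat.le_of_dvd
      · obtain ⟨i, -, hi⟩ := Finset.exists_ne_zero_of_sum_ne_zero hj'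
        obtain ⟨w, hw, hw0⟩ := Finset.exists_ne_zero_of_sum_ne_zero hi
        have hpos : 0 < R t (e i w) * w j :=
          Nat.mul_pos (axR_pos hR (by rintro h; simp [h] at hw0)) (by
            rcases Nat.eq_zero_or_pos (w j) with h | h
            · simp [h] at hw0
            · exact h)
        refine lt_of_lt_of_le hpos ?_
        refine le_trans ?_ (Finset.single_le_sum (f := fun i => ∑ w ∈ W i, R t (e i w) * w j)
          (fun _ _ => Nat.zero_le _) (Finset.mem_univ i))
        exact Finset.single_le_sum (f := fun w => R t (e i w) * w j)
          (fun _ _ => Nat.zero_le _) hw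
      · apply (Nat.modEq_zero_iff_dvd).mp
        have h2 : ∑ i, ∑ w ∈ W i, R t (e i w) * w j ≡
            ∑ i, ∑ w ∈ W i, p ^ t * e i w * w j [MOD q - 1] :=
          modEq_sum _ fun i _ => modEq_sum _ fun w _ => (axR_modEq hR hp0 t (e i w)).mul_right _
        refine h2.trans ?_
        apply Nat.modEq_zero_iff_dvd.mpr
        have : ∑ i, ∑ w ∈ W i, p ^ t * e i w * w j = p ^ t * u j := by
          simp only [hu_def, Finset.mul_sum, mul_assoc]
        rw [this]
        exact Dvd.dvd.mul_left (hu j) _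
    have h2 : ∑ j ∈ J, ∑ i, ∑ w ∈ W i, R t (e i w) * w j ≤
        ∑ i, d i * ∑ w ∈ W i, R t (e i w) := by
      calc ∑ j ∈ J, ∑ i, ∑ w ∈ W i, R t (e i w) * w j
          ≤ ∑ j, ∑ i, ∑ w ∈ W i, R t (e i w) * w j :=
            Finset.sum_le_sum_of_subset_of_nonneg (Finset.filter_subset _ _) fun _ _ _ => Nat.zero_le _
        _ = ∑ i, ∑ w ∈ W i, R t (e i w) * ∑ j, w j := by
            rw [Finset.sum_comm]
            refine Finset.sum_congr rfl fun i _ => ?_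
            rw [Finset.sum_comm]
            refine Finset.sum_congr rfl fun w _ => ?_
            rw [Finset.mul_sum]
        _ ≤ ∑ i, ∑ w ∈ W i, R t (e i w) * d i := by
            gcongr with i _ w hw
            exact hdeg i w hw
        _ = ∑ i, d i * ∑ w ∈ W i, R t (e i w) := by
            refine Finset.sum_congr rfl fun i _ => ?_
            rw [Finset.mul_sum]
            exact Finset.sum_congr rfl fun w _ => mul_comm _ _
    have h3 : ∑ i, d i * ∑ w ∈ W i, R t (e i w) ≤ (q - 1) * (D * ∑ i, τ i t + S) := by
      calc ∑ i, d i * ∑ w ∈ W i, R t (e i w)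
          = ∑ i, d i * ((q - 1) * (τ i t + 1)) := by simp_rw [hτ]
        _ = (q - 1) * (∑ i, d i * τ i t + ∑ i, d i) := by
            rw [← Finset.sum_add_distrib, Finset.mul_sum]
            exact Finset.sum_congr rfl fun i _ => by ring
        _ ≤ (q - 1) * (∑ i, D * τ i t + S) := by
            gcongr with i _
            · exact hdD i
        _ = (q - 1) * (D * ∑ i, τ i t + S) := by rw [Finset.mul_sum]
    have : (q - 1) * #J ≤ (q - 1) * (D * ∑ i, τ i t + S) := h1.trans (h2.trans h3)
    exact Nat.le_of_mul_le_mul_left this hq1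
  -- Step 2: μ ≤ ∑_i τ i t + #Z for every t
  have hμt : ∀ t, μ ≤ ∑ i, τ i t + #Z := by
    intro t
    apply hμ
    calc n = #J + #Z := hJZ.symm
      _ ≤ (D * ∑ i, τ i t + S) + D * #Z := by
          gcongr
          · exact hJle t
          · exact Nat.le_mul_of_pos_left _ hD
      _ = D * (∑ i, τ i t + #Z) + S := by ring
  -- Step 3: ∑_{t<a} τ i t ≤ v_p(multinomial) for every i
  have hE : (Nat.digits p ((q - 1) * q ^ m)).sum = a * (p - 1) := by
    rw [hq]; exact digits_sum_E hp m
  have hτV : ∀ i, ∑ t ∈ range a, τ i t ≤ padicValNat p (Nat.multinomial (W i) (e i)) := by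
    intro i
    have hL := legendre_multinomial p (W i) (e i)
    rw [he i, hE] at hL
    -- (q-1) * ∑_w s(e i w) ≥ (p-1) * ∑_w ∑_t axR = (p-1) * ∑_t (q-1)(τ+1)
    have h1 : (p - 1) * ∑ w ∈ W i, ∑ t ∈ range a, R t (e i w) ≤
        (q - 1) * ∑ w ∈ W i, (Nat.digits p (e i w)).sum := by
      rw [Finset.mul_sum, Finset.mul_sum]
      exact Finset.sum_le_sum fun w _ => axR_sum_le_digits hR hp hq (e i w)
    rw [Finset.sum_comm] at h1
    simp_rw [← hτ i] at h1
    rw [← hL, ← Finset.mul_sum, Finset.sum_add_distrib, Finset.sum_const, Finset.card_range,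
      smul_eq_mul, mul_one] at h1
    -- h1 : (p-1) * ((q-1) * (∑ τ + a)) ≤ (q-1) * ((p-1) * V + a * (p-1))
    have h2 : (q - 1) * (p - 1) * (∑ t ∈ range a, τ i t + a) ≤
        (q - 1) * (p - 1) * (padicValNat p (Nat.multinomial (W i) (e i)) + a) := by
      calc (q - 1) * (p - 1) * (∑ t ∈ range a, τ i t + a)
          = (p - 1) * ((q - 1) * (∑ x ∈ range a, τ i x + a)) := by ring
        _ ≤ (q - 1) * ((p - 1) * padicValNat p (Nat.multinomial (W i) (e i)) + a * (p - 1)) := h1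
        _ = (q - 1) * (p - 1) * (padicValNat p (Nat.multinomial (W i) (e i)) + a) := by ring
    have hpos : 0 < (q - 1) * (p - 1) := Nat.mul_pos hq1 (by omega)
    have := Nat.le_of_mul_le_mul_left h2 hpos
    omega
  -- Conclusion
  calc a * μ = ∑ t ∈ range a, μ := by simp
    _ ≤ ∑ t ∈ range a, (∑ i, τ i t + #Z) := Finset.sum_le_sum fun t _ => hμt t
    _ = ∑ i, ∑ t ∈ range a, τ i t + a * #Z := by
        rw [Finset.sum_add_distrib, Finset.sum_comm, Finset.sum_const, Finset.card_range,
          smul_eq_mul]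
    _ ≤ ∑ i, padicValNat p (Nat.multinomial (W i) (e i)) + a * #Z := by
        gcongr with i _
        exact hτV i

/-! ### 4. Arithmetic in the Witt ring `𝕎 k` of a finite field -/

section Witt
open WittVector

variable (p : ℕ) [hp : Fact p.Prime] {k : Type*} [Field k]

/-- The zeroth Witt component is the ring homomorphism `WittVector.constantCoeff`. [folklore] -/
lemma coeff_zero_eq_constantCoeff (x : WittVector p k) : x.coeff 0 = constantCoeff x := rfl

/-- `ω(t)^(q^m) = ω(t)` for the Teichmüller lift over a field with `q` elements. [folklore] -/
lemma teichmuller_pow_card_pow [Fintype k] (t : k) (m : ℕ) :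
    teichmuller p t ^ (Fintype.card k ^ m) = teichmuller p t := by
  rw [← map_pow, FiniteField.pow_card_pow]

/-- `ω(t)^(q-1)` is the indicator of `t ≠ 0`. [folklore] -/
lemma teichmuller_pow_card_sub_one [Fintype k] [DecidableEq k] (t : k) :
    teichmuller p t ^ (Fintype.card k - 1) = if t = 0 then 0 else 1 := by
  split_ifs with ht
  · rw [ht, teichmuller_zero, zero_pow]
    have := Fintype.one_lt_card (α := k); omega
  · rw [← map_pow, FiniteField.pow_card_sub_one_eq_one t ht, map_one]

omit hp in
/-- A generator of `kˣ` detects divisibility by `q - 1`. [folklore] -/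
lemma exists_pow_ne_one [Fintype k] [DecidableEq k] {u : ℕ} (hu : ¬ (Fintype.card k - 1) ∣ u) :
    ∃ g : k, g ≠ 0 ∧ g ^ u ≠ 1 := by
  obtain ⟨g, hg⟩ := IsCyclic.exists_generator (α := kˣ)
  have horder : orderOf g = Fintype.card k - 1 := by
    rw [orderOf_eq_card_of_forall_mem_zpowers hg, Nat.card_eq_fintype_card, Fintype.card_units]
  refine ⟨g, g.ne_zero, fun h => hu ?_⟩
  rw [← horder, orderOf_dvd_iff_pow_eq_one]
  ext
  simpa using h

/-- Two Witt vectors over a finite field with the same zeroth component are congruent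
modulo `p` (this uses perfectness of `k`). [folklore] -/
lemma p_dvd_of_coeff_zero_eq [Fintype k] [CharP k p] {x y : WittVector p k}
    (h : x.coeff 0 = y.coeff 0) : (p : WittVector p k) ∣ x - y := by
  rw [← Ideal.mem_span_singleton, mem_span_p_iff_coeff_zero_eq_zero, coeff_zero_eq_constantCoeff,
    map_sub, ← coeff_zero_eq_constantCoeff, ← coeff_zero_eq_constantCoeff, h, sub_self]

/-- The key congruence: if `b` lifts `t`, then `ω(t)^(q-1) ≡ b^((q-1) q^m)` modulo `p^(m'+1)`
whenever `q ^ m = p ^ m'`. (This is the lifting device behind Wan's 1995 approach; the congruence itself is standard.)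
[folklore] -/
lemma teichmuller_pow_congr [Fintype k] [CharP k p] {t : k} {b : WittVector p k}
    (h : b.coeff 0 = t) {m m' : ℕ} (hm : Fintype.card k ^ m = p ^ m') :
    (p : WittVector p k) ^ (m' + 1) ∣
      teichmuller p t ^ (Fintype.card k - 1) - b ^ ((Fintype.card k - 1) * Fintype.card k ^ m) := by
  have h1 : (p : WittVector p k) ∣ teichmuller p t - b :=
    p_dvd_of_coeff_zero_eq p (by rw [teichmuller_coeff_zero, h])
  have h2 := dvd_sub_pow_of_dvd_sub h1 m'
  rw [← hm, teichmuller_pow_card_pow] at h2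
  rw [mul_comm, pow_mul]
  exact h2.trans (sub_dvd_pow_sub_pow _ _ _)

/-- Power sums of Teichmüller representatives: `∑_{t ∈ k} ω(t)^u` is `q` for `u = 0`,
`q - 1` if `u > 0` is a multiple of `q - 1`, and `0` otherwise. [folklore] -/
lemma sum_teichmuller_pow [Fintype k] [DecidableEq k] [CharP k p] (u : ℕ) :
    ∑ t : k, teichmuller p t ^ u =
      if u = 0 then (Fintype.card k : WittVector p k)
      else if (Fintype.card k - 1) ∣ u then (Fintype.card k : WittVector p k) - 1 else 0 := by
  have hcard : 1 < Fintype.card k := Fintype.one_lt_card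
  split_ifs with hu0 hdvd
  · simp [hu0]
  · have key : ∀ t : k, teichmuller p t ^ u = if t = 0 then 0 else 1 := by
      intro t
      split_ifs with ht
      · rw [ht, teichmuller_zero, zero_pow hu0]
      · obtain ⟨c, rfl⟩ := hdvd
        rw [pow_mul, teichmuller_pow_card_sub_one, if_neg ht, one_pow]
    simp_rw [key]
    rw [Finset.sum_ite, Finset.sum_const_zero, zero_add, Finset.sum_const, nsmul_eq_mul, mul_one]
    have : (univ.filter fun t : k => ¬t = 0) = univ.erase 0 := by ext; simp
    rw [this, Finset.card_erase_of_mem (Finset.mem_univ _), Finset.card_univ, Nat.cast_sub hcard.le,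
      Nat.cast_one]
  · obtain ⟨g, hg0, hgu⟩ := exists_pow_ne_one (k := k) hdvd
    have hS : teichmuller p g ^ u * ∑ t : k, teichmuller p t ^ u = ∑ t : k, teichmuller p t ^ u := by
      rw [Finset.mul_sum]
      simp_rw [← mul_pow, ← map_mul]
      exact Fintype.sum_bijective (g * ·) (mulLeft_bijective₀ g hg0) _ _ fun _ => rfl
    have hne : teichmuller p g ^ u - 1 ≠ 0 := by
      intro h
      apply hgu
      rw [sub_eq_zero, ← map_pow] at h
      have := congrArg (fun x : WittVector p k => x.coeff 0) h
      rw [teichmuller_coeff_zero] at this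
      simpa using this
    have : (teichmuller p g ^ u - 1) * ∑ t : k, teichmuller p t ^ u = 0 := by
      rw [sub_mul, one_mul, hS, sub_self]
    exact (mul_eq_zero.mp this).resolve_left hne

/-- Divisibility of a natural number by `p ^ j` can be read off in `𝕎 k`. [folklore] -/
lemma pow_dvd_of_cast_dvd [Fintype k] [CharP k p] {j N : ℕ}
    (h : (p : WittVector p k) ^ j ∣ (N : WittVector p k)) : p ^ j ∣ N := by
  rcases Nat.eq_zero_or_pos N with rfl | hN
  · simp
  obtain ⟨v, N', hN', rfl⟩ := Nat.exists_eq_pow_mul_and_not_dvd hN.ne' p hp.out.ne_one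
  by_cases hjv : j ≤ v
  · exact (pow_dvd_pow p hjv).mul_right _
  rw [not_le] at hjv
  exfalso
  have hmem : ((p ^ v * N' : ℕ) : WittVector p k) ∈ Ideal.span {(p : WittVector p k) ^ j} :=
    Ideal.mem_span_singleton.mpr h
  have h0 := (mem_span_p_pow_iff_le_coeff_eq_zero _ j).mp hmem v hjv
  have h1 : ((p ^ v * N' : ℕ) : WittVector p k).coeff v = (N' : k) ^ p ^ v := by
    rw [Nat.cast_mul, Nat.cast_pow, mul_comm]
    have := mul_pow_charP_coeff_succ (p := p) (N' : WittVector p k) (m := 0) (n := v)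
    rw [zero_add] at this
    rw [this, coeff_zero_eq_constantCoeff, map_natCast]
  rw [h1] at h0
  have hN'k : (N' : k) ≠ 0 := by
    rw [Ne, CharP.cast_eq_zero_iff k p]; exact hN'
  exact hN'k (pow_eq_zero_iff (pow_ne_zero _ hp.out.ne_zero) |>.mp h0)

end Witt

/-! ### Generic product identities -/

/-- `∏ₓ (aₓ ∏ⱼ cⱼ^{vₓⱼ}) = (∏ₓ aₓ) ∏ⱼ cⱼ^{∑ₓ vₓⱼ}`. [folklore] -/
lemma prod_mul_prod_pow {R α β : Type*} [CommMonoid R] (s : Finset α) [Fintype β] (a : α → R)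
    (c : β → R) (v : α → β → ℕ) :
    ∏ x ∈ s, (a x * ∏ j, c j ^ v x j) = (∏ x ∈ s, a x) * ∏ j, c j ^ (∑ x ∈ s, v x j) := by
  rw [Finset.prod_mul_distrib]
  congr 1
  rw [Finset.prod_comm]
  exact Finset.prod_congr rfl fun j _ => Finset.prod_pow_eq_pow_sum _ _ _

/-- `∏ₓ (aₓ ∏ⱼ cⱼ^{wₓⱼ})^{fₓ} = (∏ₓ aₓ^{fₓ}) ∏ⱼ cⱼ^{∑ₓ fₓ wₓⱼ}`. [folklore] -/
lemma prod_mul_prod_pow_pow {R α β : Type*} [CommMonoid R] (s : Finset α) [Fintype β] (a : α → R)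
    (c : β → R) (w : α → β → ℕ) (f : α → ℕ) :
    ∏ x ∈ s, (a x * ∏ j, c j ^ (w x j)) ^ f x =
      (∏ x ∈ s, a x ^ f x) * ∏ j, c j ^ (∑ x ∈ s, f x * w x j) := by
  rw [← prod_mul_prod_pow]
  refine Finset.prod_congr rfl fun x _ => ?_
  rw [mul_pow, ← Finset.prod_pow]
  congr 1
  refine Finset.prod_congr rfl fun j _ => ?_
  rw [← pow_mul, mul_comm]

/-- Termwise congruent products are congruent. [folklore] -/
lemma dvd_prod_sub_prod {R ι : Type*} [CommRing R] (s : Finset ι) {c : R} {f g : ι → R}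
    (h : ∀ i ∈ s, c ∣ f i - g i) : c ∣ ∏ i ∈ s, f i - ∏ i ∈ s, g i := by
  classical
  induction s using Finset.induction_on with
  | empty => simp
  | insert a s ha ih =>
    rw [Finset.prod_insert ha, Finset.prod_insert ha]
    have : f a * ∏ i ∈ s, f i - g a * ∏ i ∈ s, g i =
        f a * (∏ i ∈ s, f i - ∏ i ∈ s, g i) + (f a - g a) * ∏ i ∈ s, g i := by ring
    rw [this]
    exact dvd_add (dvd_mul_of_dvd_right (ih fun i hi => h i (Finset.mem_insert_of_mem hi)) _)
      (dvd_mul_of_dvd_left (h a (Finset.mem_insert_self a s)) _)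

/-! ### 5. The Teichmüller lift of a polynomial and the main expansion -/

section Main
open WittVector MvPolynomial

variable (p : ℕ) [hp : Fact p.Prime] {k : Type*} [Field k]

variable {n : ℕ}

/-! **The Teichmüller lift of a polynomial.** Throughout, `L : MvPolynomial (Fin n) k →
(Fin n → k) → 𝕎 k` denotes a function satisfying the defining equation
`hL : L F x = ∑_{w ∈ supp F} ω(coeff_w F) · ∏_j ω(x_j)^{w_j}`: the coefficientwise Teichmüller lift
of `F`, evaluated at the Teichmüller lift of the point `x ∈ kⁿ`. (It is carried as a hypothesis on
`L` rather than as a definition, so that this file adds theorems only.) -/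

/-- `L F x` lifts `F(x)`: its zeroth Witt component is `eval x F`. [folklore] -/
lemma liftEval_coeff_zero {L : MvPolynomial (Fin n) k → (Fin n → k) → WittVector p k}
    (hL : ∀ (F : MvPolynomial (Fin n) k) (x : Fin n → k),
      L F x = ∑ w ∈ F.support, teichmuller p (coeff w F) * ∏ j, teichmuller p (x j) ^ (w j))
    (F : MvPolynomial (Fin n) k) (x : Fin n → k) :
    (L F x).coeff 0 = eval x F := by
  rw [coeff_zero_eq_constantCoeff, hL, map_sum, eval_eq']
  refine Finset.sum_congr rfl fun w _ => ?_
  rw [map_mul, map_prod, ← coeff_zero_eq_constantCoeff, teichmuller_coeff_zero]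
  congr 1
  refine Finset.prod_congr rfl fun j _ => ?_
  rw [map_pow, ← coeff_zero_eq_constantCoeff, teichmuller_coeff_zero]

/-- The multinomial expansion of `∏_i L (G i) x ^ E`, summed monomial by monomial. [folklore] -/
lemma prod_liftEval_pow_eq {L : MvPolynomial (Fin n) k → (Fin n → k) → WittVector p k}
    (hL : ∀ (F : MvPolynomial (Fin n) k) (x : Fin n → k),
      L F x = ∑ w ∈ F.support, teichmuller p (coeff w F) * ∏ j, teichmuller p (x j) ^ (w j))
    {ι : Type*} [Fintype ι] [DecidableEq ι]
    (G : ι → MvPolynomial (Fin n) k) (E : ℕ) (x : Fin n → k) :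
    ∏ i, L (G i) x ^ E =
      ∑ f ∈ Fintype.piFinset fun i => ((G i).support).piAntidiag E,
        (∏ i, ((Nat.multinomial (G i).support (f i) : WittVector p k) *
            ∏ w ∈ (G i).support, teichmuller p (coeff w (G i)) ^ f i w)) *
          ∏ j, teichmuller p (x j) ^ (∑ i, ∑ w ∈ (G i).support, f i w * w j) := by
  simp_rw [hL, Finset.sum_pow_eq_sum_piAntidiag, Finset.prod_univ_sum]
  refine Finset.sum_congr rfl fun f _ => ?_
  rw [← prod_mul_prod_pow]
  refine Finset.prod_congr rfl fun i _ => ?_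
  rw [mul_assoc, ← prod_mul_prod_pow_pow]

variable [Fintype k] [DecidableEq k] [CharP k p]

omit [CharP k p] in
/-- Step 1: the number of common zeros, computed inside `𝕎 k`.
[folklore] -/
lemma card_zeros_eq_sum {r : ℕ} (F : Fin r → MvPolynomial (Fin n) k) :
    (Fintype.card {x : Fin n → k // ∀ i, eval x (F i) = 0} : WittVector p k) =
      ∑ x : Fin n → k, ∏ i, (1 - teichmuller p (eval x (F i)) ^ (Fintype.card k - 1)) := by
  simp_rw [teichmuller_pow_card_sub_one]
  have : ∀ x : Fin n → k, ∏ i, (1 - if eval x (F i) = 0 then (0 : WittVector p k) else 1) =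
      if ∀ i, eval x (F i) = 0 then 1 else 0 := by
    intro x
    calc ∏ i, (1 - if eval x (F i) = 0 then (0 : WittVector p k) else 1)
        = ∏ i, (if eval x (F i) = 0 then (1 : WittVector p k) else 0) :=
          Finset.prod_congr rfl fun i _ => by split_ifs <;> simp
      _ = _ := by convert Fintype.prod_boole
  simp_rw [this]
  rw [Finset.sum_boole, Fintype.card_subtype]

omit [DecidableEq k] in
/-- Step 2: replacing `ω(F_i(x))^(q-1)` by `L (F i) x ^ ((q-1) q^m)` modulo `p^(m'+1)`.
(Lifting step in the manner of Wan (1995).) [folklore] -/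
lemma sum_congr_mod {L : MvPolynomial (Fin n) k → (Fin n → k) → WittVector p k}
    (hL : ∀ (F : MvPolynomial (Fin n) k) (x : Fin n → k),
      L F x = ∑ w ∈ F.support, teichmuller p (coeff w F) * ∏ j, teichmuller p (x j) ^ (w j))
    {r : ℕ} (F : Fin r → MvPolynomial (Fin n) k) {m m' : ℕ}
    (hm : Fintype.card k ^ m = p ^ m') :
    (p : WittVector p k) ^ (m' + 1) ∣
      (∑ x : Fin n → k, ∏ i, (1 - teichmuller p (eval x (F i)) ^ (Fintype.card k - 1))) -
      ∑ x : Fin n → k, ∏ i, (1 - L (F i) x ^ ((Fintype.card k - 1) * Fintype.card k ^ m)) := by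
  rw [← Finset.sum_sub_distrib]
  apply Finset.dvd_sum
  intro x _
  apply dvd_prod_sub_prod
  intro i _
  rw [sub_sub_sub_cancel_left, ← neg_sub]
  exact (teichmuller_pow_congr p (liftEval_coeff_zero p hL (F i) x) hm).neg_right

/-- Step 3 (the heart): for a finite family `G` of polynomials with `totalDegree (G i) ≤ d i ≤ D`,
`∑ d i ≤ S`, `1 ≤ D`, and `μ` dominated by every `K` with `n ≤ D K + S`,
`p^(a μ)` divides `∑_x ∏_i L (G i) x ^ ((q - 1) q ^ m)`.
[cite: Katz1971, Thm 1.0, p. 485] -/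
lemma dvd_sum_prod_liftEval_pow {L : MvPolynomial (Fin n) k → (Fin n → k) → WittVector p k}
    (hL : ∀ (F : MvPolynomial (Fin n) k) (x : Fin n → k),
      L F x = ∑ w ∈ F.support, teichmuller p (coeff w F) * ∏ j, teichmuller p (x j) ^ (w j))
    {a : ℕ} (ha : 0 < a) (hq : Fintype.card k = p ^ a)
    {ι : Type*} [Fintype ι] [DecidableEq ι]
    (G : ι → MvPolynomial (Fin n) k) (d : ι → ℕ) (D S μ : ℕ)
    (hdeg : ∀ i, (G i).totalDegree ≤ d i) (hdD : ∀ i, d i ≤ D) (hD : 1 ≤ D) (hS : ∑ i, d i ≤ S)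
    (hμ : ∀ K : ℕ, n ≤ D * K + S → μ ≤ K) (m : ℕ) :
    (p : WittVector p k) ^ (a * μ) ∣
      ∑ x : Fin n → k, ∏ i, L (G i) x ^ ((Fintype.card k - 1) * Fintype.card k ^ m) := by
  classical
  simp_rw [prod_liftEval_pow_eq p hL]
  rw [Finset.sum_comm]
  apply Finset.dvd_sum
  intro f hf
  rw [← Finset.mul_sum]
  -- ∑_x ∏_j ω(x j)^(u j) = ∏_j S(u j)
  have hpowsum : ∀ u : Fin n → ℕ, ∑ x : Fin n → k, ∏ j, teichmuller p (x j) ^ u j =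
      ∏ j : Fin n, ∑ t : k, teichmuller p t ^ u j := by
    intro u
    rw [Finset.prod_univ_sum]
    simp only [Fintype.piFinset_univ]
  rw [hpowsum]
  have hf' : ∀ i, f i ∈ ((G i).support).piAntidiag ((Fintype.card k - 1) * Fintype.card k ^ m) :=
    fun i => Fintype.mem_piFinset.mp hf i
  have he : ∀ i, ∑ w ∈ (G i).support, f i w = (Fintype.card k - 1) * Fintype.card k ^ m :=
    fun i => (Finset.mem_piAntidiag.mp (hf' i)).1
  by_cases hdiv : ∀ j, (Fintype.card k - 1) ∣ ∑ i, ∑ w ∈ (G i).support, f i w * w j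
  · -- all exponents are multiples of q - 1
    have hSval : ∀ j, ∑ t : k, teichmuller p t ^ (∑ i, ∑ w ∈ (G i).support, f i w * w j) =
        if ∑ i, ∑ w ∈ (G i).support, f i w * w j = 0 then (Fintype.card k : WittVector p k)
        else (Fintype.card k : WittVector p k) - 1 := by
      intro j
      rw [sum_teichmuller_pow]
      split_ifs with h0 h1
      · rfl
      · rfl
      · exact absurd (hdiv j) h1
    simp_rw [hSval]
    rw [Finset.prod_ite, Finset.prod_const, Finset.prod_const]
    -- the valuation bound
    have hcore := core_bound hp.out ha hq (fun i => (G i).support) f d D S μ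
      (fun i w hw => by
        have := le_totalDegree (p := G i) hw
        rw [Finsupp.sum_fintype _ _ (fun _ => rfl)] at this
        exact this.trans (hdeg i))
      hdD hD hS hμ he hdiv
    -- p^(∑ V) ∣ ∏ multinomial
    have h1 : (p : WittVector p k) ^ (∑ i, padicValNat p (Nat.multinomial (G i).support (f i))) ∣
        ∏ i, ((Nat.multinomial (G i).support (f i) : WittVector p k) *
            ∏ w ∈ (G i).support, teichmuller p (coeff w (G i)) ^ f i w) := by
      rw [← Finset.prod_pow_eq_pow_sum]
      apply Finset.prod_dvd_prod_of_dvd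
      intro i _
      apply Dvd.dvd.mul_right
      have : p ^ padicValNat p (Nat.multinomial (G i).support (f i)) ∣
          Nat.multinomial (G i).support (f i) := pow_padicValNat_dvd
      have := Nat.cast_dvd_cast (α := WittVector p k) this
      rwa [Nat.cast_pow] at this
    have h2 : (p : WittVector p k) ^
        (a * #(univ.filter fun j : Fin n => ∑ i, ∑ w ∈ (G i).support, f i w * w j = 0)) ∣
        (Fintype.card k : WittVector p k) ^
            #(univ.filter fun j : Fin n => ∑ i, ∑ w ∈ (G i).support, f i w * w j = 0) *
          ((Fintype.card k : WittVector p k) - 1) ^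
            #(univ.filter fun j : Fin n => ¬∑ i, ∑ w ∈ (G i).support, f i w * w j = 0) := by
      apply Dvd.dvd.mul_right
      rw [pow_mul, hq, Nat.cast_pow]
    refine (pow_dvd_pow _ hcore).trans ?_
    rw [pow_add]
    exact mul_dvd_mul h1 h2
  · -- some exponent is not a multiple of q - 1: the power sum vanishes
    push Not at hdiv
    obtain ⟨j, hj⟩ := hdiv
    have h0 : ∑ t : k, teichmuller p t ^ (∑ i, ∑ w ∈ (G i).support, f i w * w j) = 0 := by
      rw [sum_teichmuller_pow, if_neg, if_neg hj]
      intro h; rw [h] at hj; exact hj (dvd_zero _)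
    rw [Finset.prod_eq_zero (Finset.mem_univ j) h0, mul_zero]
    exact dvd_zero _

/-- Step 4: the alternating expansion `∏ (1 - g_i) = ∑_B (-1)^|B| ∏_{i∈B} g_i` and the
divisibility of each partial product. [cite: Katz1971, Thm 1.0, p. 485] -/
lemma dvd_sum_prod_one_sub {L : MvPolynomial (Fin n) k → (Fin n → k) → WittVector p k}
    (hL : ∀ (F : MvPolynomial (Fin n) k) (x : Fin n → k),
      L F x = ∑ w ∈ F.support, teichmuller p (coeff w F) * ∏ j, teichmuller p (x j) ^ (w j))
    {a : ℕ} (ha : 0 < a) (hq : Fintype.card k = p ^ a)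
    {r : ℕ} (F : Fin r → MvPolynomial (Fin n) k) (d : Fin r → ℕ) (D S μ : ℕ)
    (hdeg : ∀ i, (F i).totalDegree ≤ d i) (hdD : ∀ i, d i ≤ D) (hD : 1 ≤ D) (hS : ∑ i, d i ≤ S)
    (hμ : ∀ K : ℕ, n ≤ D * K + S → μ ≤ K) (m : ℕ) :
    (p : WittVector p k) ^ (a * μ) ∣
      ∑ x : Fin n → k, ∏ i, (1 - L (F i) x ^ ((Fintype.card k - 1) * Fintype.card k ^ m)) := by
  classical
  have hexp : ∀ x : Fin n → k,
      ∏ i, (1 - L (F i) x ^ ((Fintype.card k - 1) * Fintype.card k ^ m)) =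
        ∑ B ∈ (univ : Finset (Fin r)).powerset, (-1 : WittVector p k) ^ #B *
          ∏ i ∈ B, L (F i) x ^ ((Fintype.card k - 1) * Fintype.card k ^ m) := by
    intro x
    rw [Finset.prod_sub]
    refine Finset.sum_congr rfl fun B _ => ?_
    rw [Finset.prod_const_one, mul_one]
  simp_rw [hexp]
  rw [Finset.sum_comm]
  apply Finset.dvd_sum
  intro B _
  rw [← Finset.mul_sum]
  apply Dvd.dvd.mul_left
  -- pass to the subtype ↥B
  have hsub : ∀ x : Fin n → k,
      ∏ i ∈ B, L (F i) x ^ ((Fintype.card k - 1) * Fintype.card k ^ m) =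
        ∏ i : B, L (F i) x ^ ((Fintype.card k - 1) * Fintype.card k ^ m) :=
    fun x => (Finset.prod_coe_sort B _).symm
  simp_rw [hsub]
  refine dvd_sum_prod_liftEval_pow p hL ha hq (fun i : B => F i) (fun i => d i) D S μ
    (fun i => hdeg i) (fun i => hdD i) hD ?_ hμ m
  calc ∑ i : B, d i = ∑ i ∈ B, d i := Finset.sum_coe_sort B d
    _ ≤ ∑ i, d i := Finset.sum_le_sum_of_subset_of_nonneg (Finset.subset_univ B) fun _ _ _ =>
        Nat.zero_le _
    _ ≤ S := hS

/-- Step 5: the Ax–Katz divisibility in `p`-power form, for a finite field of characteristic `p`.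
[cite: Katz1971, Thm 1.0, p. 485] -/
theorem katz_dvd_charP {a : ℕ} (ha : 0 < a) (hq : Fintype.card k = p ^ a)
    {r : ℕ} (F : Fin r → MvPolynomial (Fin n) k) (d : Fin r → ℕ) (D S μ : ℕ)
    (hdeg : ∀ i, (F i).totalDegree ≤ d i) (hdD : ∀ i, d i ≤ D) (hD : 1 ≤ D) (hS : ∑ i, d i ≤ S)
    (hμ : ∀ K : ℕ, n ≤ D * K + S → μ ≤ K) :
    p ^ (a * μ) ∣ Fintype.card {x : Fin n → k // ∀ i, eval x (F i) = 0} := by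
  -- the Teichmüller lift of a polynomial (see the discussion before `liftEval_coeff_zero`)
  obtain ⟨L, hL⟩ : ∃ L : MvPolynomial (Fin n) k → (Fin n → k) → WittVector p k,
      ∀ (F : MvPolynomial (Fin n) k) (x : Fin n → k),
        L F x = ∑ w ∈ F.support, teichmuller p (coeff w F) * ∏ j, teichmuller p (x j) ^ (w j) :=
    ⟨_, fun _ _ => rfl⟩
  apply pow_dvd_of_cast_dvd p (k := k)
  rw [card_zeros_eq_sum]
  have hm : Fintype.card k ^ μ = p ^ (a * μ) := by rw [hq, ← pow_mul]
  have h1 := sum_congr_mod p hL F hm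
  have h2 := dvd_sum_prod_one_sub p hL ha hq F d D S μ hdeg hdD hD hS hμ μ
  have h3 : (p : WittVector p k) ^ (a * μ) ∣ (p : WittVector p k) ^ (a * μ + 1) :=
    pow_dvd_pow _ (Nat.le_succ _)
  have := dvd_add (h3.trans h1) h2
  rwa [sub_add_cancel] at this

end Main

end AxKatzProof

open AxKatzProof in
/-- **Katz's theorem (1971)** — discharge of the named fact `katz_card_zeros_dvd`.
[cite: Katz1971, Thm 1.0, p. 485] -/
theorem katz_card_zeros_dvd_holds : katz_card_zeros_dvd := by
  intro k _ _ _ n r F d hr hd hF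
  obtain ⟨p, hchar⟩ := CharP.exists k
  obtain ⟨a, hprime, hcard⟩ := FiniteField.card k p
  haveI : Fact p.Prime := ⟨hprime⟩
  set D : ℕ := Finset.univ.sup d with hD
  set μ : ℕ := Int.toNat ⌈((n : ℚ) - ∑ i, (d i : ℚ)) / ((D : ℕ) : ℚ)⌉ with hμ
  have hD1 : 1 ≤ D := le_trans (hd ⟨0, hr⟩) (Finset.le_sup (f := d) (Finset.mem_univ _))
  have hμK : ∀ K : ℕ, n ≤ D * K + ∑ i, d i → μ ≤ K := by
    intro K hK
    rw [hμ, Int.toNat_le, Int.ceil_le, div_le_iff₀ (by exact_mod_cast hD1)]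
    have : (n : ℚ) ≤ D * K + ∑ i, d i := by exact_mod_cast hK
    push_cast at this ⊢
    linarith
  rw [hcard, ← pow_mul]
  exact katz_dvd_charP p (k := k) a.pos hcard F d D (∑ i, d i) μ hF
    (fun i => Finset.le_sup (f := d) (Finset.mem_univ i)) hD1 le_rfl hμK

open AxKatzProof in
/-- **Ax's theorem (1964)** — discharge of the named fact `ax_card_zeros_dvd`, obtained from the
same argument with `r = 1` (`D = S = d`, exponent `b = ⌈n/d⌉ - 1 = (n + d - 1)/d - 1`).
[cite: Ax1964, main theorem; = Katz1971 Thm 1.0 with one polynomial] -/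
theorem ax_card_zeros_dvd_holds : ax_card_zeros_dvd := by
  intro k _ _ _ n d F hd hF
  obtain ⟨p, hchar⟩ := CharP.exists k
  obtain ⟨a, hprime, hcard⟩ := FiniteField.card k p
  haveI : Fact p.Prime := ⟨hprime⟩
  have hμK : ∀ K : ℕ, n ≤ d * K + d → (n + d - 1) / d - 1 ≤ K := by
    intro K hK
    have h1 : (n + d - 1) / d ≤ K + 1 := by
      rw [Nat.div_le_iff_le_mul_add_pred hd]
      have : d * (K + 1) = d * K + d := by ring
      omega
    omega
  have key := katz_dvd_charP p (k := k) a.pos hcard (fun _ : Fin 1 => F) (fun _ => d) d d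
    ((n + d - 1) / d - 1) (fun _ => hF) (fun _ => le_rfl) hd (by simp) hμK
  rw [hcard, ← pow_mul]
  convert key using 1
  exact Fintype.card_congr (Equiv.subtypeEquivRight fun x => by simp)

end Literature.FieldTheory.QuasiAlgClosed

end
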